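/-
Copyright (c) 2026 the pub-hodgecm-mathlib formalisation cell (harness21).  Prover seat hodgecm-mathlib-F0P3a-p06 (g26), 2026-09-03.  E1 BRICK LEDGER row 56-B3(59∕K2′-datum) «TAME
TWINS OF THE ROW-59 DATUM FILES», FILE (C) of 3 (E1 keeper ∕ dealer F0P3a-p03 (g30) 04:51:02Z «=» ×3 — §1 ONLY; census `F0/P3a/F0P3a-p06/g26/b359/CENSUS-B3-59.v1.F0P3ap06g26.md`).
-/
import Summits.HodgeConjecture.HodgeConjecture.Theorems.F0P3cStCharTSEPTraceOneAtDatumRamified   -- FILE (B)-RAM (this seat): `innerG_char_self_eq_one_of_isPseudoCoeff_epTwoFamilies_of_neg`; brings ★ (B) UNR, ★ H-RAM, ★ PCT-OUT, ★ 57-B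
import Summits.HodgeConjecture.HodgeConjecture.Theorems.F0P3cStCharTSTreeOrbitDataGqsRamified    -- FILE (A)-RAM (this seat): `exists_vertexOrbitData_gqs_of_neg` (`ι₀ := Bool`), `exists_edgeOrbitData_gqs_of_v_two` (`ι₁ := Unit`) based at `d₁`
import Summits.HodgeConjecture.HodgeConjecture.Theorems.F0P3cStCharTSEPNormOneUnr                -- ★ (C) UNR (F0P3-p01 g24) p853546: nothing re-used by name; imported so the twin sits next to its sibling in the import graph
import HarnessLib

/-!
# Row 56-B3(59), FILE (C) — THE TAME TWIN of ★ `F0P3cStCharTSEPNormOneUnr` §1: EP-NORM-ONE `⟨χ_σ, χ_σ⟩_e = 1` in row 58's 3-TERM letters MODULO the pseudo-coefficient binder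
# `hpc3`, on the `U(Φ₃)(L⁺_v)` tree at a TAMELY RAMIFIED place (`σ_w ϖ = −ϖ`, `|2|_w = 1`) — Rogawski 1990 §12.6; Schneider–Stuhler 1997 §III.4

Cell `pub/hodgecm-mathlib` (D-0151), crux H413 = `stmt-HodgeConjecture-24833`; lane `--kind proof --supports stmt-HodgeConjecture-24833 --as helper` (THEOREMS ONLY: no definition ∕
instance ∕ notation ∕ named fact ∕ `sorry`; count-neutral: closes no node).  Namespace `Summit.HodgeConjecture.HodgeConjecture.Cruxes.H413.F0P3cStCharTSEPNormOneRamified`.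
Sibling of ★ `…F0P3cStCharTSEPNormOneUnr` §1 (row 59 GLUE F, F0P3-p01 (g24)) on ★ B3(53)'s pattern: its head `innerG_char_self_eq_one_of_isPseudoCoeff_epThree` re-issued `_of_neg` with
the unramified datum `hd` replaced IN ITS SLOT (after `{ϖ}`, before `eA`) by the seven TAME letters `hσ hvσ hϖ hσϖ hres h2 hnorm` of ★ `isTree_latticeGraph_three_of_neg` (IN ORDER);
every other binder (`d₁ P₀ P₂ P₁ hP₀ hP₂ hP₁`, `τ₀ τ₂ τ₁ hτρᵢ hτᵢ`, `f₀ f₂ f₁ hfPᵢ hf0ᵢ`, `r hx₀`, `hsplit`, ★ PCT-OUT's `𝔇 hμG hreg hM1 hWIF hC1 hC2 hC3 hL2`, `hpc3`) and the conclusion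
VERBATIM; proof = ★'s with the orbit data from FILE (A)-RAM and the two-family head from FILE (B)-RAM.  ★ (C) §2 (the S2a discharge `…_of_unramified_explicit`, «next edition») is
NOT twinned: HONEST RESIDUE — a TAME supplier of `hpc3` (`IsPseudoCoeff` of the EP function at a ramified place) is the K1 head's `hv`-widening (LEAD T15-42 «organ consequence»).
HONEST LABEL: count-neutral datum helper; TAME road GO-LOW (LEAD T15-42); WILD (dyadic) places stay PRINT (`h2 : |2| = 1` is a binder); E1 = PRINT until the rider rides; h413
OPEN; HC_CM is proved only modulo the 7 printed citations (2 remaining named inputs hLiu418 = stmt-HodgeConjecture-24832, h413 = stmt-HodgeConjecture-24833) until rung 0 closes;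
nothing printed is asserted here.

## References
* [Rogawski1990] J. D. Rogawski, *Automorphic Representations of Unitary Groups in Three Variables* (1990): §12.6 Prop. 12.6.1 (a) p. 188.
* [SchneiderStuhler1997] P. Schneider, U. Stuhler, *Representation theory and sheaves on the Bruhat–Tits building*, Publ. Math. IHÉS 85 (1997): §III.4.
* [Kottwitz1988] R. E. Kottwitz, *Tamagawa numbers*, Ann. of Math. 127 (1988): §2.
-/

set_option autoImplicit false

set_option linter.dupNamespace false

noncomputable section

open NumberField IsDedekindDomain MeasureTheory Measure Filter Topology
open scoped Pointwise Valued WithZero Matrix MatrixGroups BigOperators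
open Literature.NumberTheory.Rogawski1990 Literature.NumberTheory.Rogawski1990.Ch12Sec5
open Literature.NumberTheory.Automorphic Literature.NumberTheory.Automorphic.UnitaryGroup Literature.NumberTheory.Automorphic.UnitaryLatticeTree
open Literature.NumberTheory.Automorphic.HermitianLattice Literature.NumberTheory.GaloisRepresentations
open Literature.Combinatorics.SimpleGraph Literature.Combinatorics.SimpleGraph.OrientedIncidence

namespace Summit.HodgeConjecture.HodgeConjecture.Cruxes.H413.F0P3cStCharTSEPNormOneRamified

open Summit.HodgeConjecture.HodgeConjecture.Cruxes.H413
open Summit.HodgeConjecture.HodgeConjecture.Cruxes.H413.F0P3cStCharTSEPTraceOneAtDatum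
open Summit.HodgeConjecture.HodgeConjecture.Cruxes.H413.F0P3cStCharTSEPTraceOneAtDatumRamified
open Summit.HodgeConjecture.HodgeConjecture.Cruxes.H413.F0P3cStCharTSTreeOrbitDataGqs
open Summit.HodgeConjecture.HodgeConjecture.Cruxes.H413.F0P3cStCharTSTreeOrbitDataGqsRamified

section Head

variable (L : Type) [Field L] [NumberField L] [IsCMField L] (v : HeightOneSpectrum (𝓞 ↥(maximalRealSubfield L)))

/-- **EP-NORM-ONE AT A TAMELY RAMIFIED PLACE, in row 58's 3-TERM letters — `⟨χ_σ, χ_σ⟩_e = 1` MODULO the pseudo-coefficient binder `hpc3`** (twin of ★ `innerG_char_self_eq_one_of_isPseudoCoeff_epThree`: `hd` ↦ the seven letters of ★ `isTree_latticeGraph_three_of_neg` in its slot, every other binder and the conclusion VERBATIM; orbit data by FILE (A)-RAM, the two-family head by FILE (B)-RAM; HONEST RESIDUE: a TAME `hpc3` supplier is the K1 head's `hv`-widening, not this file).  For the base edge `d₁` with stabilisers `P₀ P₂ P₁`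
(`hP₀ hP₂ hP₁`), the local representations `τ₀ τ₂ τ₁` (coercion laws `hτρᵢ`, trivial on the levels `hτᵢ`), the `K`-type pieces `f₀ f₂ f₁` (★ 42 letters `hfPᵢ hf0ᵢ`), an
irreducible smooth `r` with `r.ρ.fixedPoints (U x₀) ≠ ⊥`, `hsplit`, and `hpc3 : 𝔇.IsPseudoCoeff [r] (μ(P₀)⁻¹ f₀ + μ(P₂)⁻¹ f₂ − μ(P₁)⁻¹ f₁)` (row 58 S2a's conclusion, token for token):
`𝔇.innerG (𝔇.char [r]) (𝔇.char [r]) = 1`.  Proof: the orbit data based at `d₁` (★ `exists_vertexOrbitData_gqs`, `ι₀ := Bool`; ★ `exists_edgeOrbitData_gqs`, `ι₁ := Unit`) turns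
`(P₀, P₂ ; P₁)`, `(τ₀, τ₂ ; τ₁)`, `(f₀, f₂ ; f₁)` into ★ 57-B's families, and ★ `innerG_char_self_eq_one_of_isPseudoCoeff_epTwoFamilies` applies — its two-family EP function is this
3-term `f` (`Fintype.sum_bool`, `Fintype.sum_unique`). [cite: Rogawski1990, §12.6 Prop. 12.6.1 (a) p. 188] [cite: SchneiderStuhler1997, §III.4] [cite: Kottwitz1988, §2] -/
theorem innerG_char_self_eq_one_of_isPseudoCoeff_epThree_of_neg
    (hns : ∀ w : PlacesOver L v, IsCMField.complexConj L • w.1 = w.1)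
    (w : PlacesOver L v) (hw : IsCMField.complexConj L • w.1 = w.1) {ϖ : (w.1.adicCompletion L)}
    (hσ : ∀ x, (galAdicCompletionMap (L := L) (IsCMField.complexConj L) hw) ((galAdicCompletionMap (L := L) (IsCMField.complexConj L) hw) x) = x) (hvσ : ∀ x, Valued.v ((galAdicCompletionMap (L := L) (IsCMField.complexConj L) hw) x) = Valued.v x) (hϖ : Valued.v ϖ = WithZero.exp (-1 : ℤ))
    (hσϖ : (galAdicCompletionMap (L := L) (IsCMField.complexConj L) hw) ϖ = -ϖ) (hres : ∀ x : (w.1.adicCompletion L), Valued.v x ≤ 1 → Valued.v ((galAdicCompletionMap (L := L) (IsCMField.complexConj L) hw) x - x) < 1) (h2 : Valued.v (2 : (w.1.adicCompletion L)) = 1) (hnorm : ∀ u : (w.1.adicCompletion L), (galAdicCompletionMap (L := L) (IsCMField.complexConj L) hw) u = u → Valued.v (u - 1) < 1 → ∃ z : (w.1.adicCompletion L), z * (galAdicCompletionMap (L := L) (IsCMField.complexConj L) hw) z = u ∧ Valued.v (z - 1) ≤ Valued.v (u - 1))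
    (eA : (Gqs L v) ≃ₜ* ↥(unitaryGroupOfForm (galAdicCompletionMap (L := L) (IsCMField.complexConj L) hw) ((StdForm.antidiagonal 3).over (w.1.adicCompletion L))))
    {a : (Gqs L v) →* ((latticeGraph (galAdicCompletionMap (L := L) (IsCMField.complexConj L) hw) ϖ ((StdForm.antidiagonal 3).over (w.1.adicCompletion L))) ≃g (latticeGraph (galAdicCompletionMap (L := L) (IsCMField.complexConj L) hw) ϖ ((StdForm.antidiagonal 3).over (w.1.adicCompletion L))))} (ha : ∀ g, a g = latticeGraphIso (galAdicCompletionMap (L := L) (IsCMField.complexConj L) hw) ϖ ((StdForm.antidiagonal 3).over (w.1.adicCompletion L)) (eA g))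
    [MeasurableSpace (Gqs L v)] [BorelSpace (Gqs L v)]
    [∀ γ : Gqs L v, MeasurableSpace (Gqs L v ⧸ Subgroup.centralizer ({γ} : Set (Gqs L v)))] [MeasurableSpace (Gqs L v ⧸ Subgroup.center (Gqs L v))]
    {H : Type} [Group H] [TopologicalSpace H] [IsTopologicalGroup H] [MeasurableSpace H]
    (νQv : Measure (Gqs L v)) [νQv.IsHaarMeasure] [νQv.IsMulRightInvariant]
    -- the §12.5 datum and ★ PCT-OUT's letters
    (𝔇 : EllipticData (Gqs L v) H) (hμG : 𝔇.μG = νQv)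
    (hreg : ∀ γ : Gqs L v, γ ∈ 𝔇.regG ↔ IsRegularElt (γ.val : GL (Fin 3) (UnitaryGroup.LocalRing L v)))
    (hM1 : ∀ π : IrrClass (Gqs L v), Measurable (𝔇.char π) ∧ LocallyIntegrable (𝔇.char π) 𝔇.μG ∧
      (∀ x ∈ 𝔇.regG, ∀ᶠ y in 𝓝 x, 𝔇.char π y = 𝔇.char π x) ∧
      ∀ φ : Gqs L v → ℂ, IsLocSmooth φ → π.smoothTrace 𝔇.μG φ = ∫ x, φ x * 𝔇.char π x ∂𝔇.μG)
    (hWIF : 𝔇.WeylIntegrationFormula) (hC1 : 𝔇.EllCartanSubset) (hC2 : 𝔇.EllCartanAE) (hC3 : 𝔇.NonEllCartanAE) (hL2 : 𝔇.L2CharOnTorusAll)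
    (τ : Orientation (latticeGraph (galAdicCompletionMap (L := L) (IsCMField.complexConj L) hw) ϖ ((StdForm.antidiagonal 3).over (w.1.adicCompletion L)))) (hτ : ∀ d, τ.tail d < τ.head d)
    {e : ℕ} {U : {M : Submodule 𝒪[(w.1.adicCompletion L)] (Fin 3 → (w.1.adicCompletion L)) // IsVertex (galAdicCompletionMap (L := L) (IsCMField.complexConj L) hw) ϖ ((StdForm.antidiagonal 3).over (w.1.adicCompletion L)) M} → Subgroup (Gqs L v)}
    (hU : ∀ x g, g ∈ U x ↔ mapGL ((eA g : ↥(unitaryGroupOfForm (galAdicCompletionMap (L := L) (IsCMField.complexConj L) hw) ((StdForm.antidiagonal 3).over (w.1.adicCompletion L)))) : GL (Fin 3) (w.1.adicCompletion L)) x.1 = x.1 ∧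
      x.1.map ((Matrix.toLin' ((((eA g : ↥(unitaryGroupOfForm (galAdicCompletionMap (L := L) (IsCMField.complexConj L) hw) ((StdForm.antidiagonal 3).over (w.1.adicCompletion L)))) : GL (Fin 3) (w.1.adicCompletion L)) : Matrix (Fin 3) (Fin 3) (w.1.adicCompletion L)) - 1)).restrictScalars 𝒪[(w.1.adicCompletion L)]) ≤ scaleLattice (ϖ ^ (e + 1)) x.1)
    -- the base edge and its stabilisers (★ 48-datum ∕ row 58 letters)
    (d₁ : (latticeGraph (galAdicCompletionMap (L := L) (IsCMField.complexConj L) hw) ϖ ((StdForm.antidiagonal 3).over (w.1.adicCompletion L))).edgeSet) (P₀ P₂ P₁ : Subgroup (Gqs L v))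
    (hP₀ : ∀ g, g ∈ P₀ ↔ a g (τ.head d₁) = τ.head d₁) (hP₂ : ∀ g, g ∈ P₂ ↔ a g (τ.tail d₁) = τ.tail d₁) (hP₁ : ∀ g, g ∈ P₁ ↔ (a g).mapEdgeSet d₁ = d₁)
    (r : SmoothIrrep (Gqs L v)) (he : ∃ x₀ : {M : Submodule 𝒪[(w.1.adicCompletion L)] (Fin 3 → (w.1.adicCompletion L)) // IsVertex (galAdicCompletionMap (L := L) (IsCMField.complexConj L) hw) ϖ ((StdForm.antidiagonal 3).over (w.1.adicCompletion L)) M}, r.ρ.fixedPoints (U x₀) ≠ ⊥)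
    -- the three local representations and their `K`-type pieces (★ 48-datum ∕ row 58 letters)
    (τ₀ : Representation ℂ ↥P₀ ↥(r.ρ.fixedPoints (U (τ.head d₁))))
    (hτρ₀ : ∀ (p : ↥P₀) (x : ↥(r.ρ.fixedPoints (U (τ.head d₁)))), ((τ₀ p x : ↥(r.ρ.fixedPoints (U (τ.head d₁)))) : r.V) = r.ρ (p : (Gqs L v)) (x : r.V))
    (τ₂ : Representation ℂ ↥P₂ ↥(r.ρ.fixedPoints (U (τ.tail d₁))))
    (hτρ₂ : ∀ (p : ↥P₂) (x : ↥(r.ρ.fixedPoints (U (τ.tail d₁)))), ((τ₂ p x : ↥(r.ρ.fixedPoints (U (τ.tail d₁)))) : r.V) = r.ρ (p : (Gqs L v)) (x : r.V))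
    (τ₁ : Representation ℂ ↥P₁ ↥(r.ρ.fixedPoints (U (τ.head d₁) ⊔ U (τ.tail d₁))))
    (hτρ₁ : ∀ (p : ↥P₁) (x : ↥(r.ρ.fixedPoints (U (τ.head d₁) ⊔ U (τ.tail d₁)))), ((τ₁ p x : ↥(r.ρ.fixedPoints (U (τ.head d₁) ⊔ U (τ.tail d₁)))) : r.V) = r.ρ (p : (Gqs L v)) (x : r.V))
    {f₀ f₂ f₁ : (Gqs L v) → ℂ}
    (hfP₀ : ∀ (g : (Gqs L v)) (hg : g ∈ P₀), f₀ g = Representation.character τ₀ ⟨g, hg⟩⁻¹) (hf0₀ : ∀ g ∉ P₀, f₀ g = 0)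
    (hfP₂ : ∀ (g : (Gqs L v)) (hg : g ∈ P₂), f₂ g = Representation.character τ₂ ⟨g, hg⟩⁻¹) (hf0₂ : ∀ g ∉ P₂, f₂ g = 0)
    (hfP₁ : ∀ (g : (Gqs L v)) (hg : g ∈ P₁), f₁ g = Representation.character τ₁ ⟨g, hg⟩⁻¹) (hf0₁ : ∀ g ∉ P₁, f₁ g = 0)
    -- every SMOOTH self-extension of `σ` splits (★ 40″ ∕ ★ 46″ at the families)
    (hsplit : ∀ (E : Type) [AddCommGroup E] [Module ℂ E] (ρE : Representation ℂ (Gqs L v) E), ρE.IsSmooth →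
      ∀ (i : r.ρ.IntertwiningMap ρE) (p : ρE.IntertwiningMap r.ρ), Function.Injective i → LinearMap.ker p.toLinearMap = LinearMap.range i.toLinearMap →
        Function.Surjective p → ∃ s : r.ρ.IntertwiningMap ρE, p.comp s = Representation.IntertwiningMap.id r.ρ)
    -- row 58's witnessed head S2a: the 3-term EP function IS a pseudo-coefficient of `σ = [r]`
    (hpc3 : 𝔇.IsPseudoCoeff (IrrClass.mk r)
      ((((νQv.real (P₀ : Set (Gqs L v)))⁻¹ : ℂ)) • f₀ + (((νQv.real (P₂ : Set (Gqs L v)))⁻¹ : ℂ)) • f₂ - (((νQv.real (P₁ : Set (Gqs L v)))⁻¹ : ℂ)) • f₁)) :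
    𝔇.innerG (𝔇.char (IrrClass.mk r)) (𝔇.char (IrrClass.mk r)) = 1 := by
  classical
  obtain ⟨x₀, hx₀⟩ := he
  -- the orbit data based at `d₁` (★ TreeOrbitDataGqs)
  obtain ⟨idx₀, tr₀, hidx₀, hidx₀a, htr₀⟩ := exists_vertexOrbitData_gqs_of_neg L v w hw hσ hvσ hϖ hσϖ hres h2 hnorm eA ha τ hτ d₁
  obtain ⟨tr₁, htr₁⟩ := exists_edgeOrbitData_gqs_of_v_two L v w hw hσ hvσ hϖ h2 eA ha τ hτ d₁
  -- the Bool-indexed vertex families built from `(P₀, τ₀, f₀ ; P₂, τ₂, f₂)` and the Unit-indexed edge family `(P₁, τ₁, f₁)`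
  let σ₀ : ∀ b : Bool, Representation ℂ ↥(cond b P₀ P₂) ↥(r.ρ.fixedPoints (U (cond b (τ.head d₁) (τ.tail d₁)))) := fun b =>
    match b with
    | true => τ₀
    | false => τ₂
  have hP : ∀ (b : Bool) (g : Gqs L v), g ∈ cond b P₀ P₂ ↔ a g (cond b (τ.head d₁) (τ.tail d₁)) = cond b (τ.head d₁) (τ.tail d₁) := fun b => by
    cases b
    · exact hP₂
    · exact hP₀
  have hσ₀ : ∀ (b : Bool) (p : ↥(cond b P₀ P₂)) (x : ↥(r.ρ.fixedPoints (U (cond b (τ.head d₁) (τ.tail d₁))))),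
      ((σ₀ b p x : ↥(r.ρ.fixedPoints (U (cond b (τ.head d₁) (τ.tail d₁))))) : r.V) = r.ρ (p : Gqs L v) (x : r.V) := fun b => by
    cases b
    · exact hτρ₂
    · exact hτρ₀
  have hfP : ∀ (b : Bool) (g : Gqs L v) (hg : g ∈ cond b P₀ P₂), cond b f₀ f₂ g = (σ₀ b).character ⟨g, hg⟩⁻¹ := fun b => by
    cases b
    · exact hfP₂
    · exact hfP₀
  have hf0 : ∀ (b : Bool), ∀ g ∉ cond b P₀ P₂, cond b f₀ f₂ g = 0 := fun b => by
    cases b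
    · exact hf0₂
    · exact hf0₀
  -- the two-family EP function of these families is the 3-term `f`
  have hf : ((∑ b : Bool, ((νQv.real (cond b P₀ P₂ : Set (Gqs L v)) : ℂ))⁻¹ • cond b f₀ f₂) -
      ∑ _u : Unit, ((νQv.real (P₁ : Set (Gqs L v)) : ℂ))⁻¹ • f₁) =
      (((νQv.real (P₀ : Set (Gqs L v)))⁻¹ : ℂ)) • f₀ + (((νQv.real (P₂ : Set (Gqs L v)))⁻¹ : ℂ)) • f₂ - (((νQv.real (P₁ : Set (Gqs L v)))⁻¹ : ℂ)) • f₁ := by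
    rw [Fintype.sum_bool, Fintype.sum_unique]
    rfl
  have hpc : 𝔇.IsPseudoCoeff (IrrClass.mk r) ((∑ b : Bool, ((νQv.real (cond b P₀ P₂ : Set (Gqs L v)) : ℂ))⁻¹ • cond b f₀ f₂) -
      ∑ _u : Unit, ((νQv.real (P₁ : Set (Gqs L v)) : ℂ))⁻¹ • f₁) := by
    rw [hf]; exact hpc3
  exact innerG_char_self_eq_one_of_isPseudoCoeff_epTwoFamilies_of_neg L v hns w hw hσ hvσ hϖ hσϖ hres h2 hnorm eA ha νQv 𝔇 hμG hreg hM1 hWIF hC1 hC2 hC3 hL2 τ hτ hU r hx₀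
    (fun b => cond b (τ.head d₁) (τ.tail d₁)) idx₀ tr₀ hidx₀ hidx₀a htr₀ (fun b => cond b P₀ P₂) hP σ₀ hσ₀
    (fun _ : Unit => d₁) (fun _ => ()) tr₁ (fun _ => rfl) (fun _ _ => rfl) (fun d => htr₁ d) (fun _ => P₁) (fun _ => hP₁) (fun _ => τ₁) (fun _ => hτρ₁)
    (f₀ := fun b => cond b f₀ f₂) hfP hf0 (f₁ := fun _ => f₁) (fun _ => hfP₁) (fun _ => hf0₁) hsplit hpc

end Head

end Summit.HodgeConjecture.HodgeConjecture.Cruxes.H413.F0P3cStCharTSEPNormOneRamified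

end
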